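import Mathlib
import HarnessLib
import HarnessLib.Audit
import Summits.PneNP.Statement
import Literature.Computability.Complexity.ApproximateCounting
import Literature.Computability.Complexity.Randomized
import Literature.Computability.Complexity.GraphEncodings
import Literature.Computability.Complexity.Counting
import Literature.Computability.MetaComplexity.DistProblems
import Literature.Combinatorics.SimpleGraph.TreeDecomposition
import HarnessLib.Audit.Status.Attr

/-!
Route: PhaseTwins

DORMANT since 2026-08-22T04:32:47Z (reconciler: no traction for 5.1 d (last activity item-evidence-added at 2026-08-17T02:23:49Z); parked, not closed — `ledger route dormant route-PneNP-PhaseTwins --off` to reactivate) — unstaffed, not closed; items shared with open routes are served there. `ledger route dormant <id> --off` reactivates.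

Route PneNP/PhaseTwins — "above the uniqueness threshold the hard-core partition function has no
FBPP approximation scheme" (statistical physics × finite model theory; realises idea card
PneNP/PneNP/phase-coexistence-twins-counting).

THESIS X (it suffices to show). Words: for some Δ ≥ 3 and some rational activity λ = p/q above the
tree-uniqueness threshold λ_c(Δ) = (Δ−1)^{Δ−1}/(Δ−2)^Δ, NO deterministic polynomial-time transducer
F reading its coins u from the query (an FBPP machine in the sense of Aaronson–Arkhipov Def. 2.4,
exactly the format `countQuery/countEstimate` of
Literature/Computability/Complexity/ApproximateCounting.lean) (1 + 1/kη)-approximates, with failure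
probability ≤ 1/kδ over u, the hard-core count N(x) = Σ_{I independent in G_x} p^{|I|} q^{n−|I|} =
q^n · Z_{G_x}(p/q) of the max-degree-≤Δ graph G_x on n vertices encoded by x (`encodingGraph`; N(x)
:= 0 off the promise), for all unary accuracy/confidence parameters kη, kδ ≥ 1 and every polynomial
coin budget.
Lean (decl NoFBPPApproxAboveUniqueness, elaborates rc 0 in the planner's Sketch.lean):
∃ Δ p q : ℕ, 3 ≤ Δ ∧ 0 < q ∧ ((Δ:ℝ)−1)^(Δ−1)/((Δ:ℝ)−2)^Δ < p/q ∧ ¬ ∃ F ∈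
Literature.Computability.Complexity.FP, ∃ c r : Polynomial ℕ, ∀ x kη kδ, 0 < kη → 0 < kδ →
Literature.Computability.Complexity.uniformProb (c.eval (|x| + r.eval |x| + kη + kδ)) {u | ¬
IsApproxCount kη (N Δ p q x) (countEstimate F x (r.eval |x|) kη kδ u)} ≤ 1/kδ,
with N inlined as `match encodingGraph.decode x with | none => 0 | some G => if G.2.maxDegree ≤ Δ
then ∑ I : Finset (Fin G.1), (if G.2.IsIndepSet ↑I then p ^ I.card * q ^ (G.1 − I.card) else 0) else
0` (r is the unary padding slot 1^m of countQuery; it only fixes the query format).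
POSITION. NP ⊄ BPP ⇒ X (Sly2010; SlySun2014; GalanisStefankovicVigoda2016 Thm 1: for all Δ ≥ 3 and
all λ > λ_c(T_Δ) no FPRAS unless NP = RP) and X ⇒ P ≠ NP (Stockmeyer1985 / AaronsonArkhipovToC2013
Thm 4.1 = `stockmeyerApproxCounting_holds`, PROVED in the tree). X is therefore P≠NP-hard in
substance; the route's content is the ladder of approximation classes for which "no approximation
above λ_c(Δ)" is provable now, by one mechanism (phase coexistence ⇒ twins), see the rationale.

ASSEMBLY (decl Assembly): HardcoreCountSharpP → NoFBPPApproxAboveUniqueness → PneNP. Proof plan, no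
named fact needed: ¬PneNP gives Nondeterministic.NP ⊆ Classes.P via P_bool_eq_holds,
NP_bool_eq_holds (and P_subset_NP_holds); HardcoreCountSharpP gives R ∈ Classes.P = PRel ∅
(PRel_empty_holds) and a polynomial r with countWitnesses R (r |x|) x = N x;
stockmeyerApproxCounting_holds Oracle.empty R yields L ∈ NPRel ∅ = NP (NPRel_empty) ⊆ P, F ∈ FPRel
(Oracle.ofLanguage L) and c; Oracle.ofLanguage L ∈ FPRel ∅ = FP (P_subset_PRel_holds /
ofLanguage_mem_FPRel_of_mem_PRel / FPRel_empty_eq), so F ∈ FP (FPRel_subset_FP_of_mem_FP);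
Stockmeyer's guarantee at m := r.eval |x| is literally the negated body of X. Contradiction.

Rationale: WHY THIS LINE (statistical physics × finite model theory). The hard-core partition function Z_G(λ)
on max-degree-Δ graphs carries the one computational threshold in counting complexity that is
located EXACTLY: FPTAS for λ < λ_c(Δ) (Weitz2006; PatelRegts2017 + PetersRegts2019 Thm 1.1), no
FPRAS for λ > λ_c(Δ) unless NP = RP (Sly2010, SlySun2014, GalanisStefankovicVigoda2016 Thm 1). X is
the unconditional upper half; NP ⊄ BPP ⇒ X ⇒ P ≠ NP, the second arrow formal here (Stockmeyer,
PROVED: `StockMachine.stockmeyerApproxCounting_holds`; the Assembly is already machine-checked in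
the planner's Sketch.lean from `_holds` bridges only). The route's content is the LADDER of
approximation classes 𝒜 for which "no 𝒜-approximation above λ_c(Δ)" is provable now, by ONE
mechanism: phase coexistence manufactures TWINS — input pairs indistinguishable to 𝒜 with different
Z. Symmetric rungs are typed by homomorphism indistinguishability over graphs of treewidth < k (=
C^k-equivalence = (k−1)-WL: Dvorak2010, Dell–Grohe–Rattan arXiv:1802.08876, CaiFurerImmerman1992)
with the tree's `Literature.Combinatorics.SimpleGraph.treewidth` and Mathlib
`SimpleGraph`/`IsIndepSet`/`→g`, so every crux is a finite statement about graphs, independent sets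
and hom counts. Imported technology: Duplicator/CFI gap twins (AtseriasDawar2019 Thm 8: 3XOR twins
of depth Ω(n)) → TrevisanEtAl2000 gadgets → MAX-CUT twins → Sly/GŠV bipartite phase gadgets
(GalanisStefankovicVigoda2016 Lemma 19) → hard-core twins; zero-freeness/cluster expansion
(PetersRegts2019, Barvinok2016, ScottSokal2005) and correlation decay (Weitz2006, BorgsEtAl2012) on
the easy side.
PLANNER'S CORRECTION OF THE CARD. M disjoint copies of a CFI pair over a cubic base of treewidth ≥ k
(max degree 3) stay C^k-equivalent while Z multiplies, so CONSTANT-factor C^k-twins exist at EVERY λ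
> 0 once Z(CFI_even(B)) ≠ Z(CFI_odd(B)) (by hand for B = K₃: Z(C₉)² − Z(C₁₈) = −2λ⁹): FPC (⊆ C^ω_∞ω,
Otto2017) cannot (1+ε)-approximate Z at any activity, and the card's rung "FPC-FPTAS below λ_c" is
DROPPED (support ConstantFactorTwinsEverywhere records the cheap fact). The transition at λ_c is
real at two OTHER scales, and these are the cruxes: DEPTH — how many pebbles pin Z_G(λ) down to a
factor 2 (C·log n below λ_c, support LogDepthContinuityBelow = zero-freeness + Taylor truncation,
the first C log(n/ε) coefficients i_s(G) being tw<s hom-count combinations; versus n^θ above, crux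
#2) — and DENSITY — fixed depth pins log Z to o(n) below λ_c (support DensityContinuityBelow =
BorgsEtAl2012 Remark 1 + Weitz2006 via r-ball censuses) versus macroscopic e^{δn} gaps above (crux
#3).
TWO-LAYER PLAN (D-0019). Layer 1 = the ranked cruxes below + typed supports; glue/splits only under
a crux that closes (first split candidate: #2 into MAX-CUT gap twins of depth Ω(n) / pebble lifting
through port-labelled gadget substitution / GŠV two-sided log Z estimate).
RANKED CRUXES. #2 PolyDepthTwinsAbove (typed): ∀Δ≥3 ∀λ>λ_c(Δ) ∃θ>0, for infinitely many n,
max-degree-Δ G, H on n vertices hom-indistinguishable over treewidth < n^θ with Z_G(λ) ≥ 2·Z_H(λ).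
New combination AD19 ∘ TSSW ∘ GŠV16; with LogDepthContinuityBelow it reads "the pebble depth of
factor-2 approximation of Z jumps from Θ(log n) to n^{Ω(1)} exactly at λ_c(Δ)" and gives
unconditional lower bounds for FPC-interpretable LP/SDP relaxations of sub-polynomial level above
λ_c (DawarWang2017). Might fail: Duplicator's strategy must survive Sly's PORT-LABELLED gadget
wiring (needs twins C^k-equivalent as edge-ordered structures), AD19 Lemma 5 expanders must have
bounded occurrence, GŠV Lemma 19 holds only a.a.s. over gadgets of size poly(n). #3
MacroscopicTwinsAbove (typed): ∀Δ≥3 ∀λ>λ_c(Δ) ∃δ>0 ∀k: C^k-twins with Z_G ≥ e^{δn} Z_H. Known in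
substance only for λ ≥ λ₀(Δ) (AD19 §5 independent-set DENSITY gap + λ^α ≤ Z ≤ 2^n λ^α); the window
(λ_c, λ₀) needs constant-size phase gadgets (GŠV's grow like n^θ, arXiv:1203.2226 p.15, giving only
e^{n^θ'} gaps) or a direct free-energy computation on CFI lifts of expanders in the coexistence
regime; may be FALSE near λ_c, which would itself locate a second threshold. #4
PseudorandomTwinsAbove (typed, crypto-strength): two polynomial-time samplable ensembles of
max-degree-Δ graph codes, advantage → 0 for every PPT distinguisher, hard-core counts separated by a
factor 8 a.a.s.; the only rung that reaches X (support glue PseudorandomTwinsImplyTarget: run F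
twice, compare); it implies one-way functions (Goldreich1990, HastadImpagliazzoLevinLuby1999) — the
honest ceiling of the line, filed so that refuters and planted-model experts can attack a precise
statement (candidate: quietly planted cuts in random regular graphs pushed through the same phase
gadgets; cf. route PneNP/PlantedClique).
KILL CRITERIA. ¬#2 at one (Δ, λ > λ_c(Δ)) — depth n^{o(1)} pins Z to a factor 2 above λ_c — kills
the mechanism: close the route. ¬#3 only relocates the density threshold (route survives on #2/#4).
An FP approximator above λ_c (¬X; would give NP ⊆ BPP by GŠV16) closes it. A refutation of a
specific #4 candidate drops the candidate, not the route; ¬#4 in general would refute OWF-type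
statements and is not expected.
NOT DECOMPOSED YET. MAX-CUT gap twins as a named intermediate; the lifting lemma; rank logic / CPT
rungs (no hom-indistinguishability characterisation exists); explicit Lasserre-level corollaries;
antiferromagnetic Ising (GŠV16 Thm 2) as second instance; the CFI identity Z_even − Z_odd; FBPP vs
FPRAS bookkeeping for ¬X.
DEFINITION REQUESTS. Definition CkEquiv (bijective k-pebble / (k−1)-WL equivalence on SimpleGraph
(Fin n), with the Dvořák bridge to the typed hom-count form); cite facts: GŠV16 Thm 1 + Lemma 19,
AD19 Thm 8, Weitz2006 Thm 2.3 (SSM below λ_c), PetersRegts2019 Thm 1.1 with Barvinok2016 Lemma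
2.2.1, Dvorak2010 Thm.
CHEAPEST FALSIFIER. A literature LOOKUP: any isomorphism-invariant polynomial-time
(1+ε)-approximation of Z_G(λ) at ONE point λ > λ_c(Δ) whose output depends only on hom counts of
depth n^{o(1)} (e.g. interpolation from a zero-free region touching the real axis above λ_c — not
expected, since zeros of max-degree-Δ independence polynomials accumulate on [λ_c, ∞):
PetersRegts2019 §1) refutes crux #2 there and closes the route; then a `kit compute` of Z for
CFI(K₄)/CFI(K₃,₃)/CFI(Petersen) even vs odd (support ConstantFactorTwinsEverywhere; by hand base K₃
gives Z(C₉)² − Z(C₁₈) = −2λ⁹ ≠ 0). Details in the cheapest_falsifier field.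

Novelty: NOVELTY (planner 2026-08-15; searched BEFORE claiming: `lit read` of arXiv:1002.0115 pp.7–8 (BCKL
Thm 3.1, Remark 1), arXiv:1806.11307 pp.4,12–13,19,24 (Atserias–Dawar Thm 8/9, §5, §6),
arXiv:1203.2226 pp.4,15 (GŠV Thm 1, gadget sizes, Lemma 19), arXiv:1701.08049 p.2 (Peters–Regts Thm
1.1); `lit galaxy search --star pdf "homomorphism indistinguishab"` (7 hits: Seppelt forbidden
minors arXiv:2302.11290, Rattan–Seppelt WL & spectra arXiv:2103.02972, Göbel–Goldberg–Roth
WL-dimension of conjunctive queries, Roberson–Seppelt Lasserre ICALP'23, NT–Maehara GHC, Schindling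
MFCS'25); crossref "Weisfeiler-Leman partition function counting independent sets" (0 relevant;
nearest Böker doi:10.37236/10973, dense graphons), crossref "lifted inference color refinement
partition function" (→ GroheEtAl2021 chapter: BP/LP fixed points are 1-WL-invariant — the known
bottom rung), crossref title check doi:10.1093/logcom/exz022; the card's two novelty audits
(audit-5, audit-15) inherited; searchd/openalex/arxiv/s2 intermittently 429/rc 75 during the
session, logged in NOTES.md).
NEAREST PRIOR ART. (1) BorgsEtAl2012 = Borgs–Chayes–Kahn–Lovász, Random Struct. Alg. 2013, Thm 3.1 +
Remark 1: for bounded-degree graph sequences LEFT convergence (hom densities from bounded-SIZE test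
graphs) implies convergence of (1/n) log Z_G(λ) for the hard-core model when λ ≤ (D−1)^{D−1}/(D−2)^D
(via Weitz2006), and not in general — this IS the density-scale positive half at the level of local
statistics; the route's  [refs: 10.37236/10973, 10.1093/logcom/exz022, 10.4230/lipics.icalp.2020.36:, 1002.0115, 1806.11307, 1203.2226, 1701.08049, 2302.11290, 2103.02972, 1802.08876, doi:10.37236/10973, doi:10.1093/logcom/exz022, doi:10.4230/lipics.icalp.2020.36, GroheEtAl2021, BorgsEtAl2012, Weitz2006, AtseriasDawar2019, Tuckerfoltz2021, Sly2010, SlySun2014, GalanisStefankovicVigoda2016, Dvorak2010, PetersRegts2019, PatelRegts]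

Barriers (technique_class: definable-inapproximability, phase-coexistence-twins): - technique_class: definable-inapproximability, phase-coexistence-twins
- Literature.Barriers.PneNP.Relativization: APPLIES to the target and the Assembly (as does
Literature.Barriers.PneNP.BoundedRelativization, next line), relocated, not evaded —
`stockmeyerApproxCounting` is stated and proved for every oracle, so P^O = NP^O yields an FP^O
approximator relative to O; X is false relative to such O and any proof of X must be
non-relativizing. They do NOT speak to cruxes #2/#3 (PolyDepthTwinsAbove, MacroscopicTwinsAbove):
oracle-free finite statements "this explicit pair of graphs is hom-indistinguishable over treewidth
< k yet has Z-ratio ≥ 2 / ≥ e^{δn}" about a syntactically bounded resource (pebble depth), where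
Duplicator wins against DEPTH, not against TIME. Honest status at the top: crux #4 ⇒ OWF ⇒ P ≠ NP is
itself a relativizing chain; the line names no non-relativizing ingredient for X.
- Literature.Barriers.PneNP.BoundedRelativization: same verdict as Relativization for the
polynomial-time-bounded oracle version — the Stockmeyer assembly and the chain #4 ⇒ OWF ⇒ P ≠ NP
relativize with bounded oracles too; cruxes #2/#3 are oracle-free and untouched; it does not evade
it at the top rung, the bet is that the twin mechanism is model-changing (indistinguishability of
explicit inputs) rather than simulation-based.
- Literature.Barriers.PneNP.NaturalProofs: not engaged. Twin theorems are properties of INPUT PAIRS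
(neither large nor constructive in the Razborov–Rudich sense)

History (route lifecycle, newest last):
- 2026-08-16T04:14:34Z · AUTO-CRUX (backfill): NoFBPPApproxAboveUniqueness — hypotheses of the deciding theorem that nothing in the route derives are cruxes (operator:999:1085951)
- 2026-08-22T04:32:47Z · DORMANT — reconciler: no traction for 5.1 d (last activity item-evidence-added at 2026-08-17T02:23:49Z); parked, not closed — `ledger route dormant route-PneNP-PhaseTwins (operator:999:3461839)

sub-problem: PneNP · status: dormant · opened planner-plancard-PneNP-PneNP-phase-coexistenc-586cfaa3-0 2026-08-15T11:07:20Z · rev 5 · ledger route-PneNP-PhaseTwins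
GENERATED by the gate from the ledger (D-0016/17). Provers cite these decls: `theorem foo : Summit.PneNP.PneNP.Theses.PhaseTwins.<Decl> := …` in Summits/PneNP/PneNP/Theorems/<Name>.lean.
-/

namespace Summit.PneNP.PneNP.Theses.PhaseTwins

open scoped BigOperators Topology Manifold Classical MeasureTheory ProbabilityTheory Matrix InnerProductSpace ComplexConjugate ContinuousMap
open Filter Set Function TopologicalSpace MeasureTheory

attribute [summit_statement] _root_.PneNP

open Literature.PNP

/-- item stmt-PneNP-2717 · crux (kind.auto-crux: conjecture-grade) · rank 0 · open · by planner
why it might fail: P≠NP-hard: X ⇒ P≠NP (Stockmeyer; stockmeyerApproxCounting_holds, proved), NP⊄BPP ⇒ X (GŠV16 Thm 1, Sly10); ¬X = FBPP schemes above λ_c(Δ) for EVERY Δ≥3. In-route X is fed only by crux #4 via glue 2723, which IS provable as typed (coin-length-advice distinguisher, see note); #2/#3 do not imply X.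
sources: GalanisStefankovicVigoda2016 Thm 1 (arXiv:1203.2226 p.4; §6 p.15 read), Sly2010 Thm 1, Thm 2.1, Lemma 2.2 (arXiv:1005.5584 pp.8-9 read), SlySun2014 Thm 1, AaronsonArkhipovToC2013 Thm 4.1, Def. 2.4, Stockmeyer1985, Literature.Computability.Complexity.StockMachine.stockmeyerApproxCounting_holds
[target] For some Δ ≥ 3 and rational λ = p/q > λ_c(Δ) = (Δ−1)^{Δ−1}/(Δ−2)^Δ there is NO transducer F
∈ FP (coins u read from the query ⟨x, 1^{r|x|}, 1^{kη}, 1^{kδ}, u⟩ = `countQuery`, answer read by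
`countEstimate`; the FBPP format of Aaronson–Arkhipov Def. 2.4 used by ApproximateCounting.lean)
that (1 + 1/kη)-approximates (`IsApproxCount`) the hard-core count N(x) = Σ_{I independent in G_x}
p^{|I|} q^{n−|I|} = q^n · Z_{G_x}(p/q) (G_x = encodingGraph.decode x with maxDegree ≤ Δ on n
vertices; N := 0 off the promise) for all x and all kη, kδ ≥ 1, with failure probability ≤ 1/kδ
under `uniformProb` over coin strings of any polynomial length c(|x| + r|x| + kη + kδ). The
polynomial r only fixes the unary padding slot 1^m of countQuery so that Stockmeyer's machine
applies verbatim in the Assembly. Position: NP ⊄ BPP ⇒ X (GalanisStefankovicVigoda2016 Thm 1: for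
all Δ ≥ 3 and all λ in the non-uniqueness region of T_Δ no FPRAS unless NP = RP; Sly2010;
SlySun2014) and X ⇒ P ≠ NP (Assembly, via Stockmeyer — proved in the tree). Card: thesis X of
PneNP/PneNP/phase-coexistence-twins-counting. -/
@[route_item "route-PneNP-PhaseTwins", crux]
def NoFBPPApproxAboveUniqueness : Prop :=
  ∃ Δ p q : ℕ, 3 ≤ Δ ∧ 0 < q ∧ ((Δ : ℝ) - 1) ^ (Δ - 1) / ((Δ : ℝ) - 2) ^ Δ < (p : ℝ) / q ∧ ¬ ∃ F ∈ Literature.Computability.Complexity.FP, ∃ c r : Polynomial ℕ, ∀ (x : List Bool) (kη kδ : ℕ), 0 < kη → 0 < kδ → Literature.Computability.Complexity.uniformProb (c.eval (x.length + r.eval x.length + kη + kδ)) {u | ¬ Literature.Computability.Complexity.IsApproxCount kη (match Literature.Computability.Complexity.encodingGraph.decode x with | none => 0 | some G => if G.2.maxDegree ≤ Δ then ∑ I : Finset (Fin G.1), (if G.2.IsIndepSet (↑I : Set (Fin G.1)) then p ^ I.card * q ^ (G.1 - I.card) else 0) else 0) (Literature.Computability.Complexity.countEstimate F x (r.eval x.length)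 kη kδ u)} ≤ 1 / (kδ : ℝ)

/-- item stmt-PneNP-2719 · crux · rank 2 · open · by planner
why it might fail: Unproved composition (AD19 §6 lists MAX CUT open): needs bounded-occurrence 3XOR twins (AD19 Lemma 5 expanders only left-regular ⇒ biregular fix), a LOCAL 3XOR→E2LIN2→MAX-CUT gap chain (no TSSW global vertex), port orders for Sly wiring; FALSE iff n^o(1)-depth hom counts pin Z to factor 2 at λ>λ_c.
sources: AtseriasDawar2019 Lemma 5 p.12, Thm 8 p.13, §6 p.24 (arXiv:1806.11307, read), Sly2010 Thm 2.1, §2.2, Lemma 2.2 (arXiv:1005.5584 pp.8-9, read), GalanisStefankovicVigoda2016 §6 Lemma 19 (arXiv:1203.2226 p.15, read), TrevisanEtAl2000 Def. 4.1, Lemma 4.3, Hastad2001, Dvorak2010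
[crux] DEPTH-SCALE TWINS ABOVE λ_c. For every Δ ≥ 3 and real λ > λ_c(Δ) there is θ > 0 such that for
infinitely many n there are graphs G, H on n vertices, both of max degree ≤ Δ,
homomorphism-indistinguishable over ALL graphs F of treewidth < n^θ (⟺ C^{k}-equivalent for k ≈ n^θ
⟺ not separated by (k−1)-dimensional Weisfeiler–Leman: Dvorak2010; Dell–Grohe–Rattan
arXiv:1802.08876 Thm 1) and yet Z_G(λ) ≥ 2·Z_H(λ), Z = Σ_{I independent} λ^{|I|}. Intended proof
(new combination): AtseriasDawar2019 Thm 8 (3XOR instances on N variables, satisfiable vs ≤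
(1/2+ε)-satisfiable, C^k-equivalent for k = Ω(N); expanders of Lemma 5) → TrevisanEtAl2000
3XOR→MAX-CUT gadgets as a linearly bounded FO-interpretation (AD19 Lemma `lem:reduction`) →
bounded-degree MAX-CUT gap twins H₀ ≡_{C^{Ω(N)}} H₁ → Sly2010 / GalanisStefankovicVigoda2016 §6
bipartite phase gadget of size poly(N) with (Δ−1)^{⌊θ' log⌋} ports, ONE fixed gadget for every
vertex of both twins (Lemma 19 holds a.a.s., so one sample serves both) → G = H₀[gadget], H =
H₁[gadget] on n = poly(N) vertices; Duplicator's bijective-pebble strategy on (H₀, H₁) lifts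
coordinatewise to the substituted graphs (a constant-factor loss in pebbles), and Sly -/
@[route_item "route-PneNP-PhaseTwins"]
def PolyDepthTwinsAbove : Prop :=
  ∀ Δ : ℕ, 3 ≤ Δ → ∀ lam : ℝ, ((Δ : ℝ) - 1) ^ (Δ - 1) / ((Δ : ℝ) - 2) ^ Δ < lam → ∃ θ : ℝ, 0 < θ ∧ ∀ n₀ : ℕ, ∃ (n : ℕ) (G H : SimpleGraph (Fin n)), n₀ ≤ n ∧ G.maxDegree ≤ Δ ∧ H.maxDegree ≤ Δ ∧ (∀ (m : ℕ) (F : SimpleGraph (Fin m)), (Literature.Combinatorics.SimpleGraph.treewidth F : ℝ) < (n : ℝ) ^ θ → Nat.card (F →g G) = Nat.card (F →g H)) ∧ 2 * (∑ I : Finset (Fin n), (if H.IsIndepSet (↑I : Set (Fin n)) then lam ^ I.card else 0)) ≤ ∑ I : Finset (Fin n), (if G.IsIndepSet (↑I : Set (Fin n)) then lam ^ I.card else 0)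

/-- item stmt-PneNP-2721 · crux · rank 4 · open · by planner
why it might fail: Stronger than X: glue 2723 is provable as typed (|r| = coinLen|x| is O(log)-bit advice fixing the threshold octave), so FALSE iff FBPP approximation above λ_c exists (⇐ NP⊆BPP, GŠV16), possibly false even with X true. As typed (index-free tests) NOT OWF-strength: Goldreich90/IL89 need the index 1^n.
sources: Goldreich1990, ImpagliazzoLuby1989 §3, HastadImpagliazzoLevinLuby1999 Thm 1.1, BogdanovTrevisan2006 Def. 2.1, AaronsonArkhipovToC2013 Def. 2.4, GalanisStefankovicVigoda2016 Thm 1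
[crux] TOP RUNG (the only one that reaches X). For some Δ ≥ 3 and rational λ = p/q > λ_c(Δ) there
are two polynomial-time samplable ensembles D₀, D₁
(Literature.Computability.MetaComplexity.Ensemble.IsPolySamplable; samples are graph codes for
encodingGraph) such that (i) every probabilistic polynomial-time distinguisher A
(RandAlg.IsPolyTime, Boolean output) has acceptance gap |Pr_{x∼D₀(n)}[A(x)=1] −
Pr_{x∼D₁(n)}[A(x)=1]| → 0 (o(1)-computational indistinguishability — weaker than negligible, enough
for the glue; stated inline with RandAlg.pr to keep the route's import cone free of the open OWF/PRG
conjectures), and (ii) for some threshold sequence t: Pr_{D₀(n)}[N(x) ≥ 8·t(n)] → 1 and Pr_{D₁(n)}[0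
< N(x) ≤ t(n)] → 1, N the hard-core count of the Target. Support PseudorandomTwinsImplyTarget
derives X (run a factor-2 FBPP approximator on the sample and on a fresh D₁-sample, compare). This
is the computational analogue of the Duplicator twins of cruxes #2/#3 (indistinguishable to ALL
polynomial-time tests instead of depth-k pebble games) and the honest ceiling of the line: samplable
+ computationally indistinguishable + statistically far ensembles exist iff one-way functions do
(Goldr -/
@[route_item "route-PneNP-PhaseTwins"]
def PseudorandomTwinsAbove : Prop :=
  ∃ Δ p q : ℕ, 3 ≤ Δ ∧ 0 < q ∧ ((Δ : ℝ) - 1) ^ (Δ - 1) / ((Δ : ℝ) - 2) ^ Δ < (p : ℝ) / q ∧ ∃ D₀ D₁ : Literature.Computability.MetaComplexity.Ensemble, D₀.IsPolySamplable ∧ D₁.IsPolySamplable ∧ (∀ A : Literature.Computability.Complexity.RandAlg (List Bool) Bool, A.IsPolyTime (id : List Bool → List Bool) Computability.encodeBool → Filter.Tendsto (fun n : ℕ => |(∑' x : List Bool, ((D₀ n) x).toReal * A.pr id x {b | b = true}) - (∑' x : List Bool, ((D₁ n) x).toReal * A.pr id x {b | b = true})|) Filter.atTop (nhds 0)) ∧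 ∃ t : ℕ → ℕ, Filter.Tendsto (fun n : ℕ => D₀.prob n {x | 8 * t n ≤ (match Literature.Computability.Complexity.encodingGraph.decode x with | none => 0 | some G => if G.2.maxDegree ≤ Δ then ∑ I : Finset (Fin G.1), (if G.2.IsIndepSet (↑I : Set (Fin G.1)) then p ^ I.card * q ^ (G.1 - I.card) else 0) else 0)}) Filter.atTop (nhds 1) ∧ Filter.Tendsto (fun n : ℕ => D₁.prob n {x | 0 < (match Literature.Computability.Complexity.encodingGraph.decode x with | none => 0 | some G => if G.2.maxDegree ≤ Δ then ∑ I : Finset (Fin G.1), (if G.2.IsIndepSet (↑I : Set (Fin G.1)) then p ^ I.card * q ^ (G.1 - I.card) else 0) else 0) ∧ (match Literature.Computability.Complexity.encodingGraph.decode x with | none => 0 | some G => if G.2.maxDegree ≤ Δ then ∑ I : Finset (Fin G.1), (if G.2.IsIndepSet (↑I : Set (Fin G.1)) then p ^ I.card * q ^ (G.1 - I.card) else 0) else 0) ≤ t n}) Filter.atTop (nhds 1)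

/-- item stmt-PneNP-2720 · support · rank 3 · open · by planner
why it might fail: Not in print; same kernel as #2 with ONE fixed gadget size n₀ (Sly10 Lemma 2.2 ⇒ log-gap ≥ |H|(c·n₀^(3θ/4)·log r·Δcut − ln n₀) = δn); known in substance only for λ ≥ 2^(1/η) (AD19 §5 α-gap, weighted VC); may be FALSE in the window (λ_c, λ₀) — a second, density-determinacy threshold.
sources: Sly2010 Thm 2.1, Lemma 2.2, §2.2 (arXiv:1005.5584 pp.8-9, read), GalanisStefankovicVigoda2016 §6 Lemma 19 (arXiv:1203.2226 p.15, read), AtseriasDawar2019 Thm 8 p.13, §5 p.19 (arXiv:1806.11307, read), BorgsEtAl2012 Thm 3.1, Remark 1 (arXiv:1002.0115 pp.7-8), Weitz2006 Thm 2.3, Dvorak2010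
[crux] DENSITY-SCALE TWINS ABOVE λ_c. For every Δ ≥ 3 and real λ > λ_c(Δ) there is δ > 0 such that
for EVERY k there are max-degree-≤Δ graphs G, H on the same n ≥ 1 vertices, hom-indistinguishable
over treewidth < k (≡ C^k-equivalent), with Z_G(λ) ≥ e^{δn}·Z_H(λ): above λ_c the free-energy
DENSITY (1/n) log Z is not determined by the C^k-type for any fixed k — the exact converse of
support DensityContinuityBelow (BorgsEtAl2012 Remark 1 + Weitz2006: below λ_c it is). KNOWN IN
SUBSTANCE for λ ≥ λ₀(Δ): AtseriasDawar2019 §5 (3SAT/3XOR → standard/FGLSS vertex-cover reductions as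
FO-interpretations) gives bounded-degree C^k-twins (any k = o(n)) whose maximum independent sets
differ by ηn, and λ^{α(G)} ≤ Z_G(λ) ≤ 2^n λ^{α(G)} yields the gap e^{(η ln λ − ln 2) n} once λ >
2^{1/η}. OPEN in the window (λ_c(Δ), λ₀(Δ)): the GŠV16 gadgets that work down to λ_c have n^θ ports
and size poly(n) (arXiv:1203.2226 p.15), so a cut gap becomes e^{Θ(N·n^θ)} = e^{o(n_total)}, not
macroscopic; a proof needs CONSTANT-size phase gadgets whose effective antiferromagnetic coupling β
between gadget phases exceeds (ln 2)/η, or a direct second-moment / interpolation computation of the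
hard-core free energy of CF -/
@[route_item "route-PneNP-PhaseTwins"]
def MacroscopicTwinsAbove : Prop :=
  ∀ Δ : ℕ, 3 ≤ Δ → ∀ lam : ℝ, ((Δ : ℝ) - 1) ^ (Δ - 1) / ((Δ : ℝ) - 2) ^ Δ < lam → ∃ δ : ℝ, 0 < δ ∧ ∀ k : ℕ, ∃ (n : ℕ) (G H : SimpleGraph (Fin n)), 0 < n ∧ G.maxDegree ≤ Δ ∧ H.maxDegree ≤ Δ ∧ (∀ (m : ℕ) (F : SimpleGraph (Fin m)), Literature.Combinatorics.SimpleGraph.treewidth F < k → Nat.card (F →g G) = Nat.card (F →g H)) ∧ Real.exp (δ * n) * (∑ I : Finset (Fin n), (if H.IsIndepSet (↑I : Set (Fin n)) then lam ^ I.card else 0)) ≤ ∑ I : Finset (Fin n), (if G.IsIndepSet (↑I : Set (Fin n)) then lam ^ I.card else 0)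

/-- item stmt-PneNP-2722 · support · rank 9 · closed · proved by Summit.PneNP.PneNP.Theorems.hardcoreCountSharpP_proof (prover) · by planner
sources: Valiant1979 §2, AroraBarak2009 Def. 17.2, Karp1972 §3 (graph encodings)
[support] For all Δ, p, q the hard-core count N_{Δ,p,q} : List Bool → ℕ (the inlined match on
encodingGraph.decode: Σ_{I independent} p^{|I|} q^{n−|I|} on the promise maxDegree ≤ Δ, else 0)
belongs to SharpP: witnesses y ∈ {0,1}^{r(|x|)} encode per vertex v a membership bit b_v and a
colour c_v in ⌈log₂(max(p,q)+1)⌉ bits with c_v < p if b_v = 1 and c_v < q if b_v = 0, trailing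
padding 0; R = {boolPair x y : x decodes to ⟨n, G⟩ with maxDegree ≤ Δ, {v : b_v = 1} independent in
G, colour bounds, padding} ∈ Classes.P and countWitnesses R (r |x|) x = N x (n ≤ |x| because the
code carries n² adjacency bits). Routine but laborious TM2 work in the style of
SharpSATMembership.lean (decoder for encodingGraph = sigmaBool encodingGraphFin via
boolPair/encodeNat; independence and degree checks; the counting bijection via Finset.card_congr /
Fintype.card_sigma). It is the first hypothesis of the Assembly. [difficulty: L] -/
@[route_item "route-PneNP-PhaseTwins", crux]
def HardcoreCountSharpP : Prop :=
  ∀ Δ p q : ℕ, (fun x : List Bool => (match Literature.Computability.Complexity.encodingGraph.decode x with | none => 0 | some G => if G.2.maxDegree ≤ Δ then ∑ I : Finset (Fin G.1), (if G.2.IsIndepSet (↑I : Set (Fin G.1)) then p ^ I.card * q ^ (G.1 - I.card) else 0) else 0 : ℕ)) ∈ Literature.Computability.Complexity.SharpP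

/-- item stmt-PneNP-2723 · support · rank 9 · closed · proved by Summit.PneNP.PneNP.Theorems.pseudorandomTwinsImplyTarget_proof (prover) · by planner
sources: Goldreich1990, AaronsonArkhipovToC2013 Def. 2.4
[support] Glue: PseudorandomTwinsAbove → NoFBPPApproxAboveUniqueness. Given F ∈ FP, c, r violating X
at the crux's (Δ, p, q), build the PPT distinguisher A(x): sample y ∼ D₁(n) with its sampler, draw
coins u, u′, output [countEstimate F x (r|x|) 1 16 u > countEstimate F y (r|y|) 1 16 u′]. On x ∼
D₀(n): N(x) ≥ 8t and N(y) ≤ t give F-value(x) ≥ N(x)/2 ≥ 4t > 2t ≥ 2N(y) ≥ F-value(y) outside events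
of probability ≤ 2/16 + o(1), so Pr[A = 1] ≥ 7/8 − o(1); on x ∼ D₁(n) the comparison is between
i.i.d. samples, so Pr[A = 1] ≤ 1/2; the gap ≥ 3/8 − o(1) does not tend to 0, contradicting clause
(i). Lean work: composing RandAlg's (sampler + two runs of F + comparison) with IsPolyTime via the
PolyTimeComputable.comp_holds toolkit (cf. LazySamplingMachine.lean, OracleAdversaryFPRel.lean) and
the probability bookkeeping over product coins (uniformProb ↔ PMF.uniformOfFintype, Ensemble.prob).
[difficulty: M] -/
@[route_item "route-PneNP-PhaseTwins"]
def PseudorandomTwinsImplyTarget : Prop :=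
  PseudorandomTwinsAbove → NoFBPPApproxAboveUniqueness

/-- item stmt-PneNP-2724 · support · rank 9 · closed · proved by Summit.PneNP.PneNP.Theorems.logDepthContinuityBelow_proof (prover) · by planner
sources: PetersRegts2019 Thm 1.1 (arXiv:1701.08049 p.2), Barvinok2016 Lemma 2.2.1, §2.2.2, PatelRegts2017 Thm 1.1, ScottSokal2005, Dvorak2010
[support] DEPTH SCALE BELOW λ_c (known in substance; partner of crux PolyDepthTwinsAbove). For Δ ≥
3, 0 ≤ λ < λ_c(Δ) and ε > 0 there is C such that any two max-degree-≤Δ graphs on n vertices that are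
hom-indistinguishable over treewidth < C·log n satisfy Z_G(λ) ≤ (1+ε)·Z_H(λ). Proof plan:
PetersRegts2019 Thm 1.1 (a complex domain D_Δ ⊇ [0, λ_c(Δ)) on which Z_G ≠ 0 for every G of max
degree ≤ Δ) + Barvinok2016 Lemma 2.2.1 and §2.2.2 (after a fixed polynomial map φ from the unit disk
into D_Δ with φ(0) = 0, φ(1) = λ, the order-m Taylor truncation of log Z_G(φ(w)) at 0 approximates
log Z_G(λ) within ε/3 for m = C₀ log(n/ε)) + the observation that the first m Taylor coefficients
depend only on the coefficients i_1(G), …, i_m(G) of Z_G (numbers of independent sets of size ≤ m),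
each a fixed rational linear combination of hom(F, G) over graphs F with ≤ m vertices, hence
treewidth ≤ m − 1 (Lovász / Curticapean–Dell–Marx inclusion–exclusion); so equal hom counts below
depth m force |log Z_G − log Z_H| ≤ 2ε/3 ≤ log(1+ε) for ε ≤ 1 (larger ε follow). n ≤ 1: the
hypothesis is vacuous only where Z_G = Z_H anyway. PatelRegts2017 Thm 1.1 is the algorithmic form
(an isomorphism-invariant FPTAS of -/
@[route_item "route-PneNP-PhaseTwins"]
def LogDepthContinuityBelow : Prop :=
  ∀ Δ : ℕ, 3 ≤ Δ → ∀ lam : ℝ, 0 ≤ lam → lam < ((Δ : ℝ) - 1) ^ (Δ - 1) / ((Δ : ℝ) - 2) ^ Δ → ∀ ε : ℝ, 0 < ε → ∃ C : ℝ, ∀ (n : ℕ) (G H : SimpleGraph (Fin n)), G.maxDegree ≤ Δ → H.maxDegree ≤ Δ → (∀ (m : ℕ) (F : SimpleGraph (Fin m)), (Literature.Combinatorics.SimpleGraph.treewidth F : ℝ) < C * Real.log n → Nat.card (F →g G) = Nat.card (F →g H)) → (∑ I : Finset (Fin n), (if G.IsIndepSet (↑I : Set (Fin n)) then lam ^ I.card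 else 0)) ≤ (1 + ε) * ∑ I : Finset (Fin n), (if H.IsIndepSet (↑I : Set (Fin n)) then lam ^ I.card else 0)

/-- item stmt-PneNP-2725 · support · rank 9 · closed · proved by Summit.PneNP.PneNP.Theorems.densityContinuityBelow_proof (prover) · by planner
sources: BorgsEtAl2012 Thm 3.1, Remark 1 (arXiv:1002.0115 pp.7-8), Weitz2006 Thm 2.3, §3, Dvorak2010, GroheEtAl2021
[support] DENSITY SCALE BELOW λ_c (known in substance: BorgsEtAl2012 Thm 3.1 + Remark 1 via
Weitz2006; partner of crux MacroscopicTwinsAbove). For Δ ≥ 3, 0 ≤ λ < λ_c(Δ), δ > 0 there is k such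
that hom-indistinguishable-over-treewidth-<k (≡ C^k-equivalent) max-degree-≤Δ graphs on n vertices
satisfy Z_G(λ) ≤ e^{δn}·Z_H(λ). Proof plan: log Z_G(λ) = ∫_0^λ (1/t)·E_{G,t}|I| dt = Σ_v ∫_0^λ
g_v^G(t) dt with g_v^G(t) = Z_{G−N[v]}(t)/Z_G(t) = P_{G,t}(I ∩ N[v] = ∅) ∈ [0,1]; Weitz2006 (SSM on
T_Δ for t < λ_c(Δ) transfers to every graph of max degree ≤ Δ through the self-avoiding-walk tree)
gives |g_v^G(t) − g(τ_v, t)| ≤ Cγ^r uniformly for t ∈ [0, λ], where τ_v is the isomorphism type of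
the rooted r-ball of v and g(τ, t) is computed on the ball alone (the tree recursion contracts
uniformly on [0, λ] ⊂ [0, λ_c)); hence |log Z_G − Σ_τ N_G(τ)·Φ(τ)| ≤ λCγ^r·n with N_G(τ) the r-ball
census; C^k-equivalence with k > (largest r-ball) + 1 equalises the census (each rooted ball type is
a C^k condition; in hom-count terms census numbers are finite linear combinations of hom counts of
graphs with ≤ Δ^{r+1} vertices); choose r with 2λCγ^r < δ. BCKL prove the convergence version
(left-convergence ⇒ converg -/
@[route_item "route-PneNP-PhaseTwins"]
def DensityContinuityBelow : Prop :=
  ∀ Δ : ℕ, 3 ≤ Δ → ∀ lam : ℝ, 0 ≤ lam → lam < ((Δ : ℝ) - 1) ^ (Δ - 1) / ((Δ : ℝ) - 2) ^ Δ → ∀ δ : ℝ, 0 < δ → ∃ k : ℕ, ∀ (n : ℕ) (G H : SimpleGraph (Fin n)), G.maxDegree ≤ Δ → H.maxDegree ≤ Δ → (∀ (m : ℕ) (F : SimpleGraph (Fin m)), Literature.Combinatorics.SimpleGraph.treewidth F < k → Nat.card (F →g G) = Nat.card (F →g H)) → (∑ I : Finset (Fin n), (if G.IsIndepSet (↑I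 : Set (Fin n)) then lam ^ I.card else 0)) ≤ Real.exp (δ * n) * ∑ I : Finset (Fin n), (if H.IsIndepSet (↑I : Set (Fin n)) then lam ^ I.card else 0)

/-- item stmt-PneNP-2726 · support · rank 9 · closed · proved by Summit.PneNP.PneNP.PhaseTwins.ConstantFactorTwins.constantFactorTwinsEverywhere_proof (prover) · by planner
sources: CaiFurerImmerman1992 §6, DawarRicherbyRossman2008 §2, Dvorak2010, Otto2017, AtseriasDawar2019 §3
[support] (The planner's correction of the card's FPC rung; presumably folklore, not found in
print.) For all Δ ≥ 3, λ > 0 and k there are max-degree-≤Δ graphs G, H on the same n ≥ 1 vertices,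
hom-indistinguishable over treewidth < k, with Z_G(λ) ≥ 2·Z_H(λ). Proof plan: a connected CUBIC base
graph B with treewidth ≥ k (cubic expanders: tw = Θ(|B|)); the Cai–Fürer–Immerman graphs CFI(B,
even), CFI(B, odd) (tree: Literature.ModelTheory.FiniteModelTheory.cfiGraph) have max degree 3
(inner vertices degree 3, outer 2^{3−2}+1 = 3), are C^k-equivalent for k ≤ tw(B)
(CaiFurerImmerman1992 §6; DawarRicherbyRossman2008 §2), hence hom-indistinguishable over treewidth <
k (Dvorak2010); the one thing to prove is Z(CFI(B,even), λ) ≠ Z(CFI(B,odd), λ) — by hand for B = K₃: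
CFI_even = C₉ ⊔ C₉, CFI_odd = C₁₈ and Z(C₉)² − Z(C₁₈) = 2(r₁r₂)⁹ = −2λ⁹ (r₁, r₂ the transfer-matrix
eigenvalues); in general one expects Z_even − Z_odd = ±2λ^{s}(…) from the ℤ₂-holonomy of independent
sets winding around the twist (first `kit compute` CFI(K₄), CFI(K₃,₃), CFI(Petersen)); then M = ⌈ln
2 / |ln(Z_even/Z_odd)|⌉ disjoint copies of each side (disjoint unions preserve C^k-equivalence; Z is
multiplicative) give the facto -/
@[route_item "route-PneNP-PhaseTwins"]
def ConstantFactorTwinsEverywhere : Prop :=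
  ∀ Δ : ℕ, 3 ≤ Δ → ∀ lam : ℝ, 0 < lam → ∀ k : ℕ, ∃ (n : ℕ) (G H : SimpleGraph (Fin n)), 0 < n ∧ G.maxDegree ≤ Δ ∧ H.maxDegree ≤ Δ ∧ (∀ (m : ℕ) (F : SimpleGraph (Fin m)), Literature.Combinatorics.SimpleGraph.treewidth F < k → Nat.card (F →g G) = Nat.card (F →g H)) ∧ 2 * (∑ I : Finset (Fin n), (if H.IsIndepSet (↑I : Set (Fin n)) then lam ^ I.card else 0)) ≤ ∑ I : Finset (Fin n), (if G.IsIndepSet (↑I : Set (Fin n)) then lam ^ I.card else 0)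

/-- item stmt-PneNP-2718 · assembly · rank 1 · closed · proved by Summit.PneNP.PneNP.Theorems.phaseTwins_assembly_proof (prover) · by planner
sources: AaronsonArkhipovToC2013 Thm 4.1, Stockmeyer1985, CookClay2006 §1
[assembly] HardcoreCountSharpP → NoFBPPApproxAboveUniqueness → PneNP. ALREADY MACHINE-CHECKED in the
planner's Sketch.lean (theorem assembly_glue_check; axioms propext, Classical.choice, Quot.sound)
from PROVED bridges only: ¬PneNP ⇒ Nondeterministic.NP ⊆ Classes.P (P_bool_eq_holds,
NP_bool_eq_holds); N ∈ SharpP gives R ∈ Classes.P ⊆ PRel ∅ (P_subset_PRel_holds) and r with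
countWitnesses R (r.eval |x|) x = N x; StockMachine.stockmeyerApproxCounting_holds Oracle.empty R
yields L ∈ NPRel ∅ = NP (NPRel_empty) ⊆ P, F ∈ FPRel (Oracle.ofLanguage L) and c;
OracleAlg.ofLanguage_mem_FPRel_of_mem_PRel + FPRel_empty_eq + FPRel_subset_FP_of_mem_FP give F ∈ FP;
Stockmeyer's bound at m := r.eval |x| is literally the negated body of X. A prover transcribes the
~25-line proof into Summits/PneNP/PneNP/Theorems/PhaseTwinsAssembly.lean (extra imports:
StockmeyerMachines, OracleEmpty, OracleEmptyFP, OracleComposition, OracleProofs, ClayProblem,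
ClayProblemProofs) and closes this item. [difficulty: provable-now] -/
@[route_item "route-PneNP-PhaseTwins", crux]
def Assembly : Prop :=
  HardcoreCountSharpP → NoFBPPApproxAboveUniqueness → PneNP

/-! D-0027 §2.1 — DECIDING THEOREM (planner-authored via `route open/edit --closes-file`; by planner-rbadge-PneNP-PhaseTwins-1611a7cd-g2-0 2026-08-15T16:16:56Z):
its hypotheses are this route's items and its conclusion the sub-problem Statement (glue_lint), and it elaborates with this file. -/

@[closes "route-PneNP-PhaseTwins"] theorem closes (hN : HardcoreCountSharpP) (hX : NoFBPPApproxAboveUniqueness) (hA : Assembly) : _root_.PneNP :=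
  hA hN hX

end Summit.PneNP.PneNP.Theses.PhaseTwins
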